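import Summits.Parity.GeneralizedHardyLittlewood.Theses.LiouvilleShiftedTables
import Summits.Parity.GeneralizedHardyLittlewood.Theses.RoughSemiprimeRigidity
import Literature.NumberTheory.Sieve.ElliottHalberstamBridgeProofs
import Summits.Parity.GeneralizedHardyLittlewood.Theorems.LiouvilleShiftedTablesEHStubLowConductor
import Summits.Parity.GeneralizedHardyLittlewood.Theorems.LiouvilleShiftedTablesEHStubReplication
import Summits.Parity.GeneralizedHardyLittlewood.Theorems.LiouvilleShiftedTablesEHStubBadModuliSparse
import Summits.Parity.GeneralizedHardyLittlewood.Theorems.LiouvilleShiftedTablesEHStubDescent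

/-!
# `EH` from top-window purity (crux `stmt-Parity-11314`, line `upward-replication-free-factorability`)

The kernel-checked CONDITIONAL content of the line.  Four of its five registered stubs are theorems
of the tree (`LowConductor.stub_lowConductor`, `Replication.stub_replication`,
`BadModuliSparse.stub_badModuliSparse`, `Descent.stub_descent`); the fifth, **top-window purity**,
is an open conjecture-grade statement (it implies the crux by this very file and is not known to
follow from it).  Composing the four theorems with the PROVED tree equivalence
`Literature.NumberTheory.Sieve.elliottHalberstam_iff_wave0_holds` (Iwaniec–Kowalski §17.1) gives:

  top-window purity ⟹ `EH` (both route decls `LiouvilleShiftedTables.EH` and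
  `RoughSemiprimeRigidity.EH`, i.e. the Elliott–Halberstam conjecture verbatim).

Top-window purity (hypothesis `TopWindowPurity` below, spelled out): for every window exponent
`0 < ε' ≤ 1/2` and every `B > 0` there are `δ₀ ∈ (0, 1/2)`, `η > 0`, `x₀` such that for `x ≥ x₀`
all moduli `m ∈ (x^{1−ε'}, 2x^{1−ε'}]` outside a set `I` with `#I ≤ x^{1−ε'−η}` satisfy
`max_{a unit} ‖φ(m)⁻¹ ∑_{χ mod m, cond χ > ⌊x^{1/2−δ₀}⌋} χ(a⁻¹) ψ(x, χ)‖ < x/(φ(m)(log x)^B)` —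
POWER-sparse impurity of the conductor-excised discrepancy in ONE dyadic window.  It is implied by
Montgomery's conjecture for `Δ♯`; EH itself yields only `(log x)^{−B'}`-density impurity (Markov),
so the hypothesis is strictly stronger than what the conclusion gives back in that window.

References: H. Davenport, *Multiplicative Number Theory*, ch. 28; H. Iwaniec, E. Kowalski,
*Analytic Number Theory*, §17.1; the line card `Cruxes/EH/Lines/upward-replication-free-factorability.md`.
-/

namespace Summit.Parity.GeneralizedHardyLittlewood.Theorems.EH.OfTopWindowPurity

/-- **Top-window purity implies the Elliott–Halberstam conjecture** (route decl
`LiouvilleShiftedTables.EH`): the composition of the landed stubs `stub_lowConductor`,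
`stub_replication`, `stub_badModuliSparse`, `stub_descent` of the line
`upward-replication-free-factorability` with the tree equivalence
`elliottHalberstam_iff_wave0_holds`, the purity statement being the only hypothesis. [folklore] -/
theorem eh_of_topWindowPurity
    (hPurity : ∀ ε' : ℝ, 0 < ε' → ε' ≤ 1 / 2 → ∀ B : ℝ, 0 < B →
      ∃ δ₀ : ℝ, 0 < δ₀ ∧ δ₀ < 1 / 2 ∧ ∃ η : ℝ, 0 < η ∧ ∃ x₀ : ℝ, ∀ x : ℝ, x₀ ≤ x →
        ∃ I : Finset ℕ, (I.card : ℝ) ≤ x ^ (1 - ε' - η) ∧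
          ∀ m ∈ Finset.Ioc ⌊x ^ (1 - ε')⌋₊ ⌊2 * x ^ (1 - ε')⌋₊, m ∉ I →
            (⨆ a : (ZMod m)ˣ,
                ‖((Nat.totient m : ℂ))⁻¹ *
                    ∑ χ ∈ (Finset.univ : Finset (DirichletCharacter ℂ m)) with
                        ⌊x ^ (1 / 2 - δ₀)⌋₊ < χ.conductor,
                      χ (a : ZMod m)⁻¹ * Literature.NumberTheory.Sieve.chebyshevPsiChar χ x‖) <
              x / ((Nat.totient m : ℝ) * Real.log x ^ B)) :
    Summit.Parity.GeneralizedHardyLittlewood.Theses.LiouvilleShiftedTables.EH :=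
  Literature.NumberTheory.Sieve.elliottHalberstam_iff_wave0_holds.mpr
    (Summit.Parity.GeneralizedHardyLittlewood.Theorems.EH.Descent.stub_descent
      Summit.Parity.GeneralizedHardyLittlewood.Theorems.EH.LowConductor.stub_lowConductor
      Summit.Parity.GeneralizedHardyLittlewood.Theorems.EH.Replication.stub_replication
      hPurity
      Summit.Parity.GeneralizedHardyLittlewood.Theorems.EH.BadModuliSparse.stub_badModuliSparse)

/-- The same implication for the second route wanting the crux, `RoughSemiprimeRigidity.EH`
(byte-identical body; definitional unfolding). [folklore] -/
theorem roughSemiprimeRigidity_eh_of_topWindowPurity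
    (hPurity : ∀ ε' : ℝ, 0 < ε' → ε' ≤ 1 / 2 → ∀ B : ℝ, 0 < B →
      ∃ δ₀ : ℝ, 0 < δ₀ ∧ δ₀ < 1 / 2 ∧ ∃ η : ℝ, 0 < η ∧ ∃ x₀ : ℝ, ∀ x : ℝ, x₀ ≤ x →
        ∃ I : Finset ℕ, (I.card : ℝ) ≤ x ^ (1 - ε' - η) ∧
          ∀ m ∈ Finset.Ioc ⌊x ^ (1 - ε')⌋₊ ⌊2 * x ^ (1 - ε')⌋₊, m ∉ I →
            (⨆ a : (ZMod m)ˣ,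
                ‖((Nat.totient m : ℂ))⁻¹ *
                    ∑ χ ∈ (Finset.univ : Finset (DirichletCharacter ℂ m)) with
                        ⌊x ^ (1 / 2 - δ₀)⌋₊ < χ.conductor,
                      χ (a : ZMod m)⁻¹ * Literature.NumberTheory.Sieve.chebyshevPsiChar χ x‖) <
              x / ((Nat.totient m : ℝ) * Real.log x ^ B)) :
    Summit.Parity.GeneralizedHardyLittlewood.Theses.RoughSemiprimeRigidity.EH :=
  eh_of_topWindowPurity hPurity

end Summit.Parity.GeneralizedHardyLittlewood.Theorems.EH.OfTopWindowPurity
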